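import Summits.HodgeConjecture.CorCM.Model.PolarContraction
import Summits.HodgeConjecture.CorCM.Model.PolarFamilyAltDual
import Summits.HodgeConjecture.CorCM.Model.PolarizationDatum
import Summits.HodgeConjecture.CorCM.Model.RosatiThetaProduct
import Summits.HodgeConjecture.CorCM.Model.AlgDualityFact
import Summits.HodgeConjecture.CorCM.Model.Prod4Degree
import HarnessLib

/-!
# COR-CM model layer, row M22 `Fact_algDuality` for `Model.universeOf` — the unconditional plug

Cell `pub-hodgecm2` (COR-CM), seat `model-1` (kernel K-a, author of record of BINDER row M22).  The assembly
`Model/AlgDuality.lean` + `Model/AlgDualityFact.lean` (b29) proves clauses (o) bijectivity, (i) algebraicity,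
(ii) CM-intertwining of `Fact_algDuality` on the corner product `P = A₀ × A₁ × A₂ × A₃` from ONE remaining input
`hR2P`: bases `b`, `y` of `H¹(P(ℂ); ℚ)`, the algebraicity `halg` of the Fourier kernel
`Σ_c pr₁^* m₄(b∘c) ∪ pr₂^* m₄(y∘c)` on `P × P`, and the Rosati tensor identity `hadj`
`Σ_a Ma^* b_a ⊗ y_a = Σ_a b_a ⊗ Mb^* y_a` for every pair `(Ma, Mb)` acting diagonally by `(a, ā)`.
This file DISCHARGES `hR2P` and concludes row M22 with no hypothesis beyond the standing named facts.

* §1 `exists_polarBasis` (generic `A : AbelianVariety ℂ`): from a rational-algebraic `θ ∈ H²(A(ℂ); ℚ)` with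
  `θ^{dim A} ≠ 0` — a basis `b` of `H¹`, the POLAR family `y` of `θ` along `b`
  (`m^*θ − pr₁^*θ − pr₂^*θ = Σ_a pr₁^*b_a ∪ pr₂^*y_a`, b16 `exists_polClass_eq_sum`), which is again a basis
  (b16 `polarFamily_linearIndependent`), and the algebraicity of every Fourier kernel
  (b16 `sum_pull_cupPowOne_cup_mem_ratAlgebraicClasses`: it is `± ℓ(θ)^i`).
* §2 `cupPow_ne_zero_of_cupPowTwo_ne_zero`: complex `(θ ⊗ 1)^g ≠ 0` ⇒ rational `θ^g ≠ 0`.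
* §3 `exists_r2p_package`: §1 + the bridge `sum_tmul_polarFamily_rosati_of_forall`
  (`Model/PolarFamilyAltDual.lean`: the polar family IS the alternating dual pairing of `ω`, `wedgeToCup ω = θ`)
  turn the DUAL-FORM Rosati identity `B_ω(φ ∘ T, ψ) = B_ω(φ, ψ ∘ T')` into the tensor form `hadj`.
* §4 `universeOf_r2p`: the model instance — `θ` := b26's Rosati-compatible algebraic polarisation class of the
  corner product of coded realisations (`var_rosatiTheta`, `Model/RosatiThetaProduct.lean`, from Shimura's
  theorem via `RosatiPolarizationCM`), `B.X = Var.scheme P` by `rfl`, `dim_unique`, `four_le_dim_prod4`;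
  and `universeOf_algDuality : (universeOf hHD hI hU h₃).Fact_algDuality`.
[cite: Shimura1998, §6.2 Theorem 4 (3)] [cite: MumfordAV1970, §16 and §20] [cite: Kleiman1968AlgebraicCycles, App. 2A]
-/

noncomputable section

open CategoryTheory MonoidalCategory CartesianMonoidalCategory
open Literature.AlgebraicTopology.SingularHomology
open Literature.AlgebraicTopology.CharacteristicClasses (cupPow)
open Literature.AlgebraicGeometry.Motives (SchemeOver ComplexPoints IsSmoothProjective bettiCohomology AbelianVariety bettiCup
  CMType)
open Literature.AlgebraicGeometry.HodgeTheory
open Literature.NumberTheory.Automorphic (cmConjRingHom)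
open Literature.NumberTheory.Automorphic.PicardCM
open scoped MonObj TensorProduct

namespace Summit.HodgeConjecture.CorCM.Model

/-! ### §1 The polar basis package of a nondegenerate algebraic `θ` -/

section PolarBasis

variable (A : AbelianVariety ℂ)

/-- **Polar basis package.** For an abelian variety `A` of dimension `g ≥ 1` and a rational-algebraic
`θ ∈ H²(A(ℂ); ℚ)` with `θ^g ≠ 0` there are bases `b`, `y` of `H¹(A(ℂ); ℚ)` (indexed by `Fin N`, `N = b₁(A)`) with
`m^*θ − pr₁^*θ − pr₂^*θ = Σ_a pr₁^* b_a ∪ pr₂^* y_a` (so `y` is the polar family of `θ` along `b`), and for every `i`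
the Fourier kernel `Σ_{c : Fin i → Fin N} pr₁^* m_i(b∘c) ∪ pr₂^* m_i(y∘c)` is a rational algebraic class of
codimension `i` on `A × A`.  (Composition of b16's `exists_polClass_eq_sum`, `polarFamily_linearIndependent`,
`polarFamily_span_eq_top`, `sum_pull_cupPowOne_cup_mem_ratAlgebraicClasses`.)
[cite: MumfordAV1970, §16, §20] -/
theorem exists_polarBasis (hg : 1 ≤ A.dim) {θ : bettiCohomology A.X 2} (hθalg : θ ∈ ratAlgebraicClasses A.X 1)
    (hθtop : cupPow ℚ θ A.dim ≠ 0) :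
    ∃ (N : ℕ) (b y : Module.Basis (Fin N) ℚ (bettiCohomology A.X 1)),
      (BettiUniverse.pull μ[A.X] 2 θ - BettiUniverse.pull (fst A.X A.X) 2 θ - BettiUniverse.pull (snd A.X A.X) 2 θ =
        ∑ a, BettiUniverse.cup (A.X ⊗ A.X) 1 1 (BettiUniverse.pull (fst A.X A.X) 1 (b a))
          (BettiUniverse.pull (snd A.X A.X) 1 (y a))) ∧
      ∀ i : ℕ, (∑ c : Fin i → Fin N, Literature.AlgebraicGeometry.Motives.bettiCup (two_mul i).symm
          (BettiUniverse.pull (fst A.X A.X) i (cupPowOne ℚ (ComplexPoints A.X) i (fun k ↦ b (c k))))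
          (BettiUniverse.pull (snd A.X A.X) i (cupPowOne ℚ (ComplexPoints A.X) i (fun k ↦ y (c k))))) ∈
        ratAlgebraicClasses (A.X ⊗ A.X) i := by
  have hA : IsSmoothProjective A.dim A.X := AbelianVariety.isSmoothProjective_holds (A := A)
  haveI : FiniteDimensional ℚ (bettiCohomology A.X 1) := finiteDimensional_bettiCohomology hA 1
  let b : Module.Basis (Fin (Module.finrank ℚ (bettiCohomology A.X 1))) ℚ (bettiCohomology A.X 1) :=
    Module.finBasis ℚ _
  obtain ⟨y, hℓ⟩ := exists_polClass_eq_sum A b θ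
  have hk : A.dim - 1 + 1 = A.dim := Nat.sub_add_cancel hg
  have hθ' : cupPow ℚ θ (A.dim - 1 + 1) ≠ 0 := by rwa [hk]
  have hLI : LinearIndependent ℚ y := polarFamily_linearIndependent A hk b hθ' hℓ
  have hsp : ⊤ ≤ Submodule.span ℚ (Set.range y) := (polarFamily_span_eq_top A hk b hθ' hℓ).ge
  refine ⟨_, b, Module.Basis.mk hLI hsp, ?_, fun i ↦ ?_⟩
  · simpa only [Module.Basis.coe_mk] using hℓ
  · simpa only [Module.Basis.coe_mk] using sum_pull_cupPowOne_cup_mem_ratAlgebraicClasses A hθalg b y hℓ i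

end PolarBasis

/-! ### §2 Non-vanishing of the top power: complex `cupPowTwo` form ⇒ rational `cupPow` form -/

section TopPower

/-- `(θ ⊗ 1)^g ≠ 0` (the tree's complex `cupPowTwo`, output shape of `rosatiTheta_prod4`) implies `θ^g ≠ 0` for the
rational `cupPow` (input shape of `polarFamily_linearIndependent`): `(θ^g) ⊗ 1 = (θ ⊗ 1)^g` (`ofRatClass_cupPow`).
[cite: HatcherAT2002, §3.2 p. 215] -/
theorem cupPow_ne_zero_of_cupPowTwo_ne_zero {Y : Type} [TopologicalSpace Y] (θ : singularCohomology ℚ ℚ Y 2) (g : ℕ)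
    (h : cupPowTwo (ofRatClass Y 2 θ) g ≠ 0) : cupPow ℚ θ g ≠ 0 := by
  intro h0
  apply h
  rw [← ofRatClass_cupPow, h0, map_zero]

end TopPower

/-! ### §3 The R2→P package from one Rosati-compatible algebraic `θ` -/

section Package

/-- **The R2→P package.**  Let `A` be an abelian variety with underlying scheme `X` (`hAX`, in the model `rfl`),
`θ ∈ H²(X(ℂ); ℚ)` rational-algebraic with `(θ ⊗ 1)^{dim A} ≠ 0`, and suppose the alternating dual pairing of every
exterior square `ω` over `θ` satisfies the dual-form Rosati identity `B_ω(φ ∘ T, ψ) = B_ω(φ, ψ ∘ T')` for all pairs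
`(T, T')` in an arbitrary "admissible" relation `Radm a T T'` (in the model: `T`, `T'` act diagonally by `a`, `ā`
through the four projections — the `IsDiagAct` data).  Then there are bases `b`, `y` of `H¹(X(ℂ); ℚ)` such that
(halg) the degree-4 Fourier kernel `Σ_c pr₁^* m₄(b∘c) ∪ pr₂^* m₄(y∘c)` is rational-algebraic on `X × X`, and
(hadj) `Σ_a T(b_a) ⊗ y_a = Σ_a b_a ⊗ T'(y_a)` for every admissible pair — the two inputs of `Model.var_algDuality`
besides the bases.  (`exists_polarBasis` + `sum_tmul_polarFamily_rosati_of_forall`.)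
[cite: MumfordAV1970, §16, §20] [cite: Shimura1998, §6.2 Theorem 4 (3)] -/
theorem exists_r2p_package (A : AbelianVariety ℂ) {X : SchemeOver ℂ} (hAX : A.X = X) (hg : 1 ≤ A.dim)
    {θ : bettiCohomology X 2} (hθalg : θ ∈ ratAlgebraicClasses X 1)
    (hθtop : cupPowTwo (ofRatClass (ComplexPoints X) 2 θ) A.dim ≠ 0)
    {K : Type*} (Radm : K → (bettiCohomology X 1 →ₗ[ℚ] bettiCohomology X 1) →
      (bettiCohomology X 1 →ₗ[ℚ] bettiCohomology X 1) → Prop)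
    (hros : ∀ ω : ⋀[ℚ]^2 (bettiCohomology X 1), wedgeToCup ℚ (ComplexPoints X) 2 ω = θ →
      ∀ (a : K) (T T' : bettiCohomology X 1 →ₗ[ℚ] bettiCohomology X 1), Radm a T T' →
        ∀ φ ψ : Module.Dual ℚ (bettiCohomology X 1),
          exteriorPower.alternatingMapToDual ℚ (bettiCohomology X 1) 2 ![φ ∘ₗ T, ψ] ω =
            exteriorPower.alternatingMapToDual ℚ (bettiCohomology X 1) 2 ![φ, ψ ∘ₗ T'] ω) :
    ∃ (N : ℕ) (b y : Module.Basis (Fin N) ℚ (bettiCohomology X 1)),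
      (∑ c : Fin 4 → Fin N, Literature.AlgebraicGeometry.Motives.bettiCup (two_mul 4).symm
          (BettiUniverse.pull (fst X X) 4 (cupPowOne ℚ (ComplexPoints X) 4 (fun k ↦ b (c k))))
          (BettiUniverse.pull (snd X X) 4 (cupPowOne ℚ (ComplexPoints X) 4 (fun k ↦ y (c k))))) ∈
        ratAlgebraicClasses (X ⊗ X) 4 ∧
      ∀ (a : K) (T T' : bettiCohomology X 1 →ₗ[ℚ] bettiCohomology X 1), Radm a T T' →
        ∑ a', T (b a') ⊗ₜ[ℚ] y a' = ∑ a', b a' ⊗ₜ[ℚ] T' (y a') := by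
  subst hAX
  obtain ⟨N, b, y, hℓ, halg⟩ :=
    exists_polarBasis A hg hθalg (cupPow_ne_zero_of_cupPowTwo_ne_zero θ A.dim hθtop)
  exact ⟨N, b, y, halg 4, fun a T T' hR ↦
    sum_tmul_polarFamily_rosati_of_forall A b hℓ T T' fun ω hω φ ψ ↦ hros ω hω a T T' hR φ ψ⟩

end Package

/-! ### §4 The model: `hR2P` for `Model.universeOf`, and row M22 `Fact_algDuality` UNCONDITIONALLY -/

section ModelUniverse

/-- **R2→P for the model universe** (the hypothesis `hR2P` of `universeOf_fact_algDuality`, discharged): for every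
CM field `K` and quadruple of CM types `Φ`, on the corner product `P = A_{Φ₀} × A_{Φ₁} × A_{Φ₂} × A_{Φ₃}` of the
coded realisations there are bases `b`, `y` of `H¹(P(ℂ); ℚ)` with (halg) the degree-4 Fourier kernel
`Σ_c pr₁^* m₄(b∘c) ∪ pr₂^* m₄(y∘c)` rational-algebraic on `P × P` and (hadj) the Rosati tensor identity
`Σ_a Ma^* b_a ⊗ y_a = Σ_a b_a ⊗ Mb^* y_a` for every pair `(Ma, Mb)` acting diagonally by `(a, ā)` (`IsDiagAct`).
Inputs: b26's `var_rosatiTheta` (a Rosati-compatible rational-algebraic polarisation class `θ` of `P` with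
`(θ ⊗ 1)^{dim P} ≠ 0`, Betti dual form), the polar basis package `exists_polarBasis` (b16's K-b), and the bridge
`sum_tmul_polarFamily_rosati_of_forall`. [cite: Shimura1998, §6.2 Theorem 4 (3)] [cite: MumfordAV1970, §16, §20] -/
theorem universeOf_r2p (hHD : exists_isReal_hodgeModel) (hI : hodgePQ_independent_of_hodgeModel)
    (hU : BallQuotientUniformisedDatum) (h₃ : CMAbelianVarietyRealised) :
    ∀ (K : CMField) (Φ : Fin 4 → CMType K), ∃ (N : ℕ) (b y : Module.Basis (Fin N) ℚ
      (Var.Coh hU h₃ (Var.prod (Var.prod (Var.prod (.cm (cmCode K (Φ 0))) (.cm (cmCode K (Φ 1))))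
        (.cm (cmCode K (Φ 2)))) (.cm (cmCode K (Φ 3)))) 1)),
        (∑ cc : Fin 4 → Fin N, bettiCup (two_mul 4).symm
        (BettiUniverse.pull
            (fst (Var.scheme hU h₃ (Var.prod (Var.prod (Var.prod (.cm (cmCode K (Φ 0))) (.cm (cmCode K (Φ 1)))) (.cm (cmCode K (Φ 2)))) (.cm (cmCode K (Φ 3)))))
              (Var.scheme hU h₃ (Var.prod (Var.prod (Var.prod (.cm (cmCode K (Φ 0))) (.cm (cmCode K (Φ 1)))) (.cm (cmCode K (Φ 2)))) (.cm (cmCode K (Φ 3)))))) 4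
          (cupPowOne ℚ (ComplexPoints
            (Var.scheme hU h₃ (Var.prod (Var.prod (Var.prod (.cm (cmCode K (Φ 0))) (.cm (cmCode K (Φ 1)))) (.cm (cmCode K (Φ 2)))) (.cm (cmCode K (Φ 3)))))) 4
            (fun p ↦ b (cc p))))
        (BettiUniverse.pull
            (snd (Var.scheme hU h₃ (Var.prod (Var.prod (Var.prod (.cm (cmCode K (Φ 0))) (.cm (cmCode K (Φ 1)))) (.cm (cmCode K (Φ 2)))) (.cm (cmCode K (Φ 3)))))
              (Var.scheme hU h₃ (Var.prod (Var.prod (Var.prod (.cm (cmCode K (Φ 0))) (.cm (cmCode K (Φ 1)))) (.cm (cmCode K (Φ 2)))) (.cm (cmCode K (Φ 3)))))) 4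
          (cupPowOne ℚ (ComplexPoints
            (Var.scheme hU h₃ (Var.prod (Var.prod (Var.prod (.cm (cmCode K (Φ 0))) (.cm (cmCode K (Φ 1)))) (.cm (cmCode K (Φ 2)))) (.cm (cmCode K (Φ 3)))))) 4
            (fun p ↦ y (cc p))))) ∈
      ratAlgebraicClasses
        (Var.scheme hU h₃ (Var.prod (Var.prod (Var.prod (.cm (cmCode K (Φ 0))) (.cm (cmCode K (Φ 1)))) (.cm (cmCode K (Φ 2)))) (.cm (cmCode K (Φ 3)))) ⊗
          Var.scheme hU h₃ (Var.prod (Var.prod (Var.prod (.cm (cmCode K (Φ 0))) (.cm (cmCode K (Φ 1)))) (.cm (cmCode K (Φ 2)))) (.cm (cmCode K (Φ 3))))) 4 ∧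
        ∀ (a : K)
        (Ma Mb : Var.Mor hU h₃ (Var.prod (Var.prod (Var.prod (.cm (cmCode K (Φ 0))) (.cm (cmCode K (Φ 1)))) (.cm (cmCode K (Φ 2)))) (.cm (cmCode K (Φ 3))))
          (Var.prod (Var.prod (Var.prod (.cm (cmCode K (Φ 0))) (.cm (cmCode K (Φ 1)))) (.cm (cmCode K (Φ 2)))) (.cm (cmCode K (Φ 3)))))
        (da db : (i : Fin 4) → Var.Mor hU h₃ (.cm (cmCode K (Φ i))) (.cm (cmCode K (Φ i)))),
        (∀ i, BettiUniverse.pull (da i) 1 =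
          (BettiUniverse.cmEndAction ((cmRealisation h₃ (cmCode K (Φ i))).θ.comp (cmCodeEquiv K (Φ i)).toRingHom)
            ((cmRealisation h₃ (cmCode K (Φ i))).exists_map_comp (cmCodeEquiv K (Φ i))) hHD hI (Var.isSmoothProjective hU h₃ (.cm (cmCode K (Φ i))))).ι a) →
        (∀ k, BettiUniverse.pull Ma k ∘ₗ
            BettiUniverse.pull (Var.comp hU h₃ (Var.fst hU h₃ _ (.cm (cmCode K (Φ 3))))
              (Var.comp hU h₃ (Var.fst hU h₃ _ (.cm (cmCode K (Φ 2)))) (Var.fst hU h₃ (.cm (cmCode K (Φ 0))) (.cm (cmCode K (Φ 1)))))) k =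
          BettiUniverse.pull (Var.comp hU h₃ (Var.fst hU h₃ _ (.cm (cmCode K (Φ 3))))
              (Var.comp hU h₃ (Var.fst hU h₃ _ (.cm (cmCode K (Φ 2)))) (Var.fst hU h₃ (.cm (cmCode K (Φ 0))) (.cm (cmCode K (Φ 1)))))) k ∘ₗ
            BettiUniverse.pull (da 0) k) →
        (∀ k, BettiUniverse.pull Ma k ∘ₗ
            BettiUniverse.pull (Var.comp hU h₃ (Var.fst hU h₃ _ (.cm (cmCode K (Φ 3))))
              (Var.comp hU h₃ (Var.fst hU h₃ _ (.cm (cmCode K (Φ 2)))) (Var.snd hU h₃ (.cm (cmCode K (Φ 0))) (.cm (cmCode K (Φ 1)))))) k =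
          BettiUniverse.pull (Var.comp hU h₃ (Var.fst hU h₃ _ (.cm (cmCode K (Φ 3))))
              (Var.comp hU h₃ (Var.fst hU h₃ _ (.cm (cmCode K (Φ 2)))) (Var.snd hU h₃ (.cm (cmCode K (Φ 0))) (.cm (cmCode K (Φ 1)))))) k ∘ₗ
            BettiUniverse.pull (da 1) k) →
        (∀ k, BettiUniverse.pull Ma k ∘ₗ
            BettiUniverse.pull (Var.comp hU h₃ (Var.fst hU h₃ _ (.cm (cmCode K (Φ 3)))) (Var.snd hU h₃ _ (.cm (cmCode K (Φ 2))))) k =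
          BettiUniverse.pull (Var.comp hU h₃ (Var.fst hU h₃ _ (.cm (cmCode K (Φ 3)))) (Var.snd hU h₃ _ (.cm (cmCode K (Φ 2))))) k ∘ₗ
            BettiUniverse.pull (da 2) k) →
        (∀ k, BettiUniverse.pull Ma k ∘ₗ BettiUniverse.pull (Var.snd hU h₃ _ (.cm (cmCode K (Φ 3)))) k =
          BettiUniverse.pull (Var.snd hU h₃ _ (.cm (cmCode K (Φ 3)))) k ∘ₗ BettiUniverse.pull (da 3) k) →
        (∀ i, BettiUniverse.pull (db i) 1 =
          (BettiUniverse.cmEndAction ((cmRealisation h₃ (cmCode K (Φ i))).θ.comp (cmCodeEquiv K (Φ i)).toRingHom)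
            ((cmRealisation h₃ (cmCode K (Φ i))).exists_map_comp (cmCodeEquiv K (Φ i))) hHD hI (Var.isSmoothProjective hU h₃ (.cm (cmCode K (Φ i))))).ι
            (cmConjRingHom K a)) →
        (∀ k, BettiUniverse.pull Mb k ∘ₗ
            BettiUniverse.pull (Var.comp hU h₃ (Var.fst hU h₃ _ (.cm (cmCode K (Φ 3))))
              (Var.comp hU h₃ (Var.fst hU h₃ _ (.cm (cmCode K (Φ 2)))) (Var.fst hU h₃ (.cm (cmCode K (Φ 0))) (.cm (cmCode K (Φ 1)))))) k =
          BettiUniverse.pull (Var.comp hU h₃ (Var.fst hU h₃ _ (.cm (cmCode K (Φ 3))))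
              (Var.comp hU h₃ (Var.fst hU h₃ _ (.cm (cmCode K (Φ 2)))) (Var.fst hU h₃ (.cm (cmCode K (Φ 0))) (.cm (cmCode K (Φ 1)))))) k ∘ₗ
            BettiUniverse.pull (db 0) k) →
        (∀ k, BettiUniverse.pull Mb k ∘ₗ
            BettiUniverse.pull (Var.comp hU h₃ (Var.fst hU h₃ _ (.cm (cmCode K (Φ 3))))
              (Var.comp hU h₃ (Var.fst hU h₃ _ (.cm (cmCode K (Φ 2)))) (Var.snd hU h₃ (.cm (cmCode K (Φ 0))) (.cm (cmCode K (Φ 1)))))) k =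
          BettiUniverse.pull (Var.comp hU h₃ (Var.fst hU h₃ _ (.cm (cmCode K (Φ 3))))
              (Var.comp hU h₃ (Var.fst hU h₃ _ (.cm (cmCode K (Φ 2)))) (Var.snd hU h₃ (.cm (cmCode K (Φ 0))) (.cm (cmCode K (Φ 1)))))) k ∘ₗ
            BettiUniverse.pull (db 1) k) →
        (∀ k, BettiUniverse.pull Mb k ∘ₗ
            BettiUniverse.pull (Var.comp hU h₃ (Var.fst hU h₃ _ (.cm (cmCode K (Φ 3)))) (Var.snd hU h₃ _ (.cm (cmCode K (Φ 2))))) k =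
          BettiUniverse.pull (Var.comp hU h₃ (Var.fst hU h₃ _ (.cm (cmCode K (Φ 3)))) (Var.snd hU h₃ _ (.cm (cmCode K (Φ 2))))) k ∘ₗ
            BettiUniverse.pull (db 2) k) →
        (∀ k, BettiUniverse.pull Mb k ∘ₗ BettiUniverse.pull (Var.snd hU h₃ _ (.cm (cmCode K (Φ 3)))) k =
          BettiUniverse.pull (Var.snd hU h₃ _ (.cm (cmCode K (Φ 3)))) k ∘ₗ BettiUniverse.pull (db 3) k) →
        ∑ a', BettiUniverse.pull Ma 1 (b a') ⊗ₜ[ℚ] y a' = ∑ a', b a' ⊗ₜ[ℚ] BettiUniverse.pull Mb 1 (y a') := by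
  intro K Φ
  obtain ⟨θ, hθalg, -, htop, hros⟩ :=
    var_rosatiTheta hHD hI hU h₃ (fun i ↦ cmCode K (Φ i)) (fun i ↦ cmCodeEquiv K (Φ i))
  -- the product abelian variety whose underlying scheme IS the model's scheme of `P` (by `rfl`)
  let B : AbelianVariety ℂ :=
    (((cmRealisation h₃ (cmCode K (Φ 0))).AV.prod (cmRealisation h₃ (cmCode K (Φ 1))).AV).prod
      (cmRealisation h₃ (cmCode K (Φ 2))).AV).prod (cmRealisation h₃ (cmCode K (Φ 3))).AV
  have hdim : B.dim = Var.dim (Var.prod (Var.prod (Var.prod (.cm (cmCode K (Φ 0))) (.cm (cmCode K (Φ 1)))) (.cm (cmCode K (Φ 2)))) (.cm (cmCode K (Φ 3)))) :=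
    dim_unique (AbelianVariety.isSmoothProjective_holds (A := B)) (Var.isSmoothProjective hU h₃ (Var.prod (Var.prod (Var.prod (.cm (cmCode K (Φ 0))) (.cm (cmCode K (Φ 1)))) (.cm (cmCode K (Φ 2)))) (.cm (cmCode K (Φ 3)))))
  have hg : 1 ≤ B.dim := by
    have h4 := four_le_dim_prod4 (fun i ↦ cmCode K (Φ i))
    rw [hdim]
    exact le_trans (by norm_num) h4
  have htop' : cupPowTwo (ofRatClass (ComplexPoints (Var.scheme hU h₃ (Var.prod (Var.prod (Var.prod (.cm (cmCode K (Φ 0))) (.cm (cmCode K (Φ 1)))) (.cm (cmCode K (Φ 2)))) (.cm (cmCode K (Φ 3)))))) 2 θ) B.dim ≠ 0 := by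
    rw [hdim]; exact htop
  obtain ⟨N, b, y, halg, hadj⟩ := exists_r2p_package B (X := Var.scheme hU h₃ (Var.prod (Var.prod (Var.prod (.cm (cmCode K (Φ 0))) (.cm (cmCode K (Φ 1)))) (.cm (cmCode K (Φ 2)))) (.cm (cmCode K (Φ 3))))) rfl hg hθalg htop'
    (K := K)
    (fun a T T' ↦
      (T ∘ₗ BettiUniverse.pull (Var.comp hU h₃ (Var.fst hU h₃ _ (.cm (cmCode K (Φ 3))))
          (Var.comp hU h₃ (Var.fst hU h₃ _ (.cm (cmCode K (Φ 2)))) (Var.fst hU h₃ (.cm (cmCode K (Φ 0))) (.cm (cmCode K (Φ 1)))))) 1 =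
        BettiUniverse.pull (Var.comp hU h₃ (Var.fst hU h₃ _ (.cm (cmCode K (Φ 3))))
          (Var.comp hU h₃ (Var.fst hU h₃ _ (.cm (cmCode K (Φ 2)))) (Var.fst hU h₃ (.cm (cmCode K (Φ 0))) (.cm (cmCode K (Φ 1)))))) 1 ∘ₗ
          (BettiUniverse.cmEndAction ((cmRealisation h₃ (cmCode K (Φ 0))).θ.comp (cmCodeEquiv K (Φ 0)).toRingHom)
            ((cmRealisation h₃ (cmCode K (Φ 0))).exists_map_comp (cmCodeEquiv K (Φ 0))) hHD hI
            (Var.isSmoothProjective hU h₃ (.cm (cmCode K (Φ 0))))).ι a) ∧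
      (T ∘ₗ BettiUniverse.pull (Var.comp hU h₃ (Var.fst hU h₃ _ (.cm (cmCode K (Φ 3))))
          (Var.comp hU h₃ (Var.fst hU h₃ _ (.cm (cmCode K (Φ 2)))) (Var.snd hU h₃ (.cm (cmCode K (Φ 0))) (.cm (cmCode K (Φ 1)))))) 1 =
        BettiUniverse.pull (Var.comp hU h₃ (Var.fst hU h₃ _ (.cm (cmCode K (Φ 3))))
          (Var.comp hU h₃ (Var.fst hU h₃ _ (.cm (cmCode K (Φ 2)))) (Var.snd hU h₃ (.cm (cmCode K (Φ 0))) (.cm (cmCode K (Φ 1)))))) 1 ∘ₗ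
          (BettiUniverse.cmEndAction ((cmRealisation h₃ (cmCode K (Φ 1))).θ.comp (cmCodeEquiv K (Φ 1)).toRingHom)
            ((cmRealisation h₃ (cmCode K (Φ 1))).exists_map_comp (cmCodeEquiv K (Φ 1))) hHD hI
            (Var.isSmoothProjective hU h₃ (.cm (cmCode K (Φ 1))))).ι a) ∧
      (T ∘ₗ BettiUniverse.pull (Var.comp hU h₃ (Var.fst hU h₃ _ (.cm (cmCode K (Φ 3)))) (Var.snd hU h₃ _ (.cm (cmCode K (Φ 2))))) 1 =
        BettiUniverse.pull (Var.comp hU h₃ (Var.fst hU h₃ _ (.cm (cmCode K (Φ 3)))) (Var.snd hU h₃ _ (.cm (cmCode K (Φ 2))))) 1 ∘ₗ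
          (BettiUniverse.cmEndAction ((cmRealisation h₃ (cmCode K (Φ 2))).θ.comp (cmCodeEquiv K (Φ 2)).toRingHom)
            ((cmRealisation h₃ (cmCode K (Φ 2))).exists_map_comp (cmCodeEquiv K (Φ 2))) hHD hI
            (Var.isSmoothProjective hU h₃ (.cm (cmCode K (Φ 2))))).ι a) ∧
      (T ∘ₗ BettiUniverse.pull (Var.snd hU h₃ _ (.cm (cmCode K (Φ 3)))) 1 =
        BettiUniverse.pull (Var.snd hU h₃ _ (.cm (cmCode K (Φ 3)))) 1 ∘ₗ
          (BettiUniverse.cmEndAction ((cmRealisation h₃ (cmCode K (Φ 3))).θ.comp (cmCodeEquiv K (Φ 3)).toRingHom)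
            ((cmRealisation h₃ (cmCode K (Φ 3))).exists_map_comp (cmCodeEquiv K (Φ 3))) hHD hI
            (Var.isSmoothProjective hU h₃ (.cm (cmCode K (Φ 3))))).ι a) ∧
      (T' ∘ₗ BettiUniverse.pull (Var.comp hU h₃ (Var.fst hU h₃ _ (.cm (cmCode K (Φ 3))))
          (Var.comp hU h₃ (Var.fst hU h₃ _ (.cm (cmCode K (Φ 2)))) (Var.fst hU h₃ (.cm (cmCode K (Φ 0))) (.cm (cmCode K (Φ 1)))))) 1 =
        BettiUniverse.pull (Var.comp hU h₃ (Var.fst hU h₃ _ (.cm (cmCode K (Φ 3))))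
          (Var.comp hU h₃ (Var.fst hU h₃ _ (.cm (cmCode K (Φ 2)))) (Var.fst hU h₃ (.cm (cmCode K (Φ 0))) (.cm (cmCode K (Φ 1)))))) 1 ∘ₗ
          (BettiUniverse.cmEndAction ((cmRealisation h₃ (cmCode K (Φ 0))).θ.comp (cmCodeEquiv K (Φ 0)).toRingHom)
            ((cmRealisation h₃ (cmCode K (Φ 0))).exists_map_comp (cmCodeEquiv K (Φ 0))) hHD hI
            (Var.isSmoothProjective hU h₃ (.cm (cmCode K (Φ 0))))).ι (cmConjRingHom K a)) ∧
      (T' ∘ₗ BettiUniverse.pull (Var.comp hU h₃ (Var.fst hU h₃ _ (.cm (cmCode K (Φ 3))))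
          (Var.comp hU h₃ (Var.fst hU h₃ _ (.cm (cmCode K (Φ 2)))) (Var.snd hU h₃ (.cm (cmCode K (Φ 0))) (.cm (cmCode K (Φ 1)))))) 1 =
        BettiUniverse.pull (Var.comp hU h₃ (Var.fst hU h₃ _ (.cm (cmCode K (Φ 3))))
          (Var.comp hU h₃ (Var.fst hU h₃ _ (.cm (cmCode K (Φ 2)))) (Var.snd hU h₃ (.cm (cmCode K (Φ 0))) (.cm (cmCode K (Φ 1)))))) 1 ∘ₗ
          (BettiUniverse.cmEndAction ((cmRealisation h₃ (cmCode K (Φ 1))).θ.comp (cmCodeEquiv K (Φ 1)).toRingHom)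
            ((cmRealisation h₃ (cmCode K (Φ 1))).exists_map_comp (cmCodeEquiv K (Φ 1))) hHD hI
            (Var.isSmoothProjective hU h₃ (.cm (cmCode K (Φ 1))))).ι (cmConjRingHom K a)) ∧
      (T' ∘ₗ BettiUniverse.pull (Var.comp hU h₃ (Var.fst hU h₃ _ (.cm (cmCode K (Φ 3)))) (Var.snd hU h₃ _ (.cm (cmCode K (Φ 2))))) 1 =
        BettiUniverse.pull (Var.comp hU h₃ (Var.fst hU h₃ _ (.cm (cmCode K (Φ 3)))) (Var.snd hU h₃ _ (.cm (cmCode K (Φ 2))))) 1 ∘ₗ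
          (BettiUniverse.cmEndAction ((cmRealisation h₃ (cmCode K (Φ 2))).θ.comp (cmCodeEquiv K (Φ 2)).toRingHom)
            ((cmRealisation h₃ (cmCode K (Φ 2))).exists_map_comp (cmCodeEquiv K (Φ 2))) hHD hI
            (Var.isSmoothProjective hU h₃ (.cm (cmCode K (Φ 2))))).ι (cmConjRingHom K a)) ∧
      (T' ∘ₗ BettiUniverse.pull (Var.snd hU h₃ _ (.cm (cmCode K (Φ 3)))) 1 =
        BettiUniverse.pull (Var.snd hU h₃ _ (.cm (cmCode K (Φ 3)))) 1 ∘ₗ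
          (BettiUniverse.cmEndAction ((cmRealisation h₃ (cmCode K (Φ 3))).θ.comp (cmCodeEquiv K (Φ 3)).toRingHom)
            ((cmRealisation h₃ (cmCode K (Φ 3))).exists_map_comp (cmCodeEquiv K (Φ 3))) hHD hI
            (Var.isSmoothProjective hU h₃ (.cm (cmCode K (Φ 3))))).ι (cmConjRingHom K a)))
    (fun ω hω a T T' hR φ ψ ↦
      hros ω hω a T T' hR.1 hR.2.1 hR.2.2.1 hR.2.2.2.1 hR.2.2.2.2.1 hR.2.2.2.2.2.1 hR.2.2.2.2.2.2.1 hR.2.2.2.2.2.2.2 φ ψ)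
  refine ⟨N, b, y, halg, fun a Ma Mb da db hda hMa₀ hMa₁ hMa₂ hMa₃ hdb hMb₀ hMb₁ hMb₂ hMb₃ ↦
    hadj a (BettiUniverse.pull Ma 1) (BettiUniverse.pull Mb 1) ⟨?_, ?_, ?_, ?_, ?_, ?_, ?_, ?_⟩⟩
  · rw [hMa₀ 1, hda 0]; rfl
  · rw [hMa₁ 1, hda 1]; rfl
  · rw [hMa₂ 1, hda 2]; rfl
  · rw [hMa₃ 1, hda 3]; rfl
  · rw [hMb₀ 1, hdb 0]; rfl
  · rw [hMb₁ 1, hdb 1]; rfl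
  · rw [hMb₂ 1, hdb 2]; rfl
  · rw [hMb₃ 1, hdb 3]; rfl

/-- **Row M22 `Fact_algDuality` for the model universe, UNCONDITIONALLY** (modulo the standing named facts
`hHD`, `hI`, `hU`, `h₃` only): the junction `universeOf_fact_algDuality` (b29, `CorCM/Model/AlgDualityFact`) applied
to `universeOf_r2p`.  Kernel K-a of BINDER row M22 — assembling (o) `FourierOpInjective`/`FourierSumBijective`
(b29/b23), (i) `CorrespondenceAlgebraic`/`FourierSumAlgebraic` (b17), (ii) `FourierIntertwine` (b22) with row M19
`var_deg_diag`, K-b `PoincareClass`/`KunnethOneOne`/`PolarContraction` (b16), R2 `RosatiTheta` (b13),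
`RosatiDualForm`/`RosatiTensorForm`/`ProductCMAction`/`RosatiThetaProd4`/`RosatiThetaProduct` (b26) over the
literature theorems `RosatiPolarizationCM` (lit-milne) / `CMTypeRosatiPolarization` (lit-deligne), the degree glue
`Prod4Degree` and the bridge `PolarFamilyAltDual` (model-1).
[cite: Shimura1998, §6.2 Theorem 4] [cite: MumfordAV1970, §16, §20] [cite: Kleiman1968AlgebraicCycles, App. 2A] -/
theorem universeOf_algDuality (hHD : exists_isReal_hodgeModel) (hI : hodgePQ_independent_of_hodgeModel)
    (hU : BallQuotientUniformisedDatum) (h₃ : CMAbelianVarietyRealised) :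
    (universeOf hHD hI hU h₃).Fact_algDuality :=
  universeOf_fact_algDuality hHD hI hU h₃ (universeOf_r2p hHD hI hU h₃)

end ModelUniverse

end Summit.HodgeConjecture.CorCM.Model

end
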